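import Summits.BirchSwinnertonDyer.Rank1Residual.Iwasawa.NonsplitTowerPrimeToP
import Summits.BirchSwinnertonDyer.BirchSwinnertonDyer.Theorems.UniversalToricDescentProPrimeToPVanishing
import Literature.NumberTheory.GaloisRepresentations.HochschildSerreLowDegree
import Literature.NumberTheory.GaloisRepresentations.LocalGaloisGroupProofs
import Literature.GroupTheory.ProfiniteSubquotients
import HarnessLib

/-!
# Route UniversalToricDescent — Greenberg–Vatsal Prop. (2.4), structural half:
# `#H¹(K_{∞,w}, B) = #H¹(I_v, B)^{Gal(K̄_v/K_{∞,w})}` at a place `v ∤ p` finitely decomposed in `K_∞`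

Lead prover bsd-wall-utd-p1 g9 (`--supports stmt-BirchSwinnertonDyer-20399`; memo ALG-HALF-21845-LOCAL
§3/§5: the VALUE of the local term `s_v` of `invariantsTransportT_algebraicHalf_lambda`). For a number
field `K`, ANY `ℤ_p`-extension `κ` (`H = ker κ = Gal(K̄/K_∞)`), a finite place `v ∤ p` NOT split
completely in `K_∞` (`hns`), `Hi = Gal(K̄_v/K_{∞,w}) = localSubgroup (ker κ) K_v ≤ Γ_{K_v}` and its normal
subgroup `I = I_{K_v}` (`absInertia`; `I ≤ Hi` since `ℤ_p`-extensions are unramified outside `p`), and a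
FINITE discrete `p`-primary `Γ_{K_v}`-module `B`:

* `coprime_index_of_quotient_localSubgroup_absInertia` — **`Hi / I` is pro-prime-to-`p`**: every open
  normal subgroup of the quotient has index prime to `p` (the tree's `relIndex_sup_inertia_coprime`,
  Greenberg LNM 1716 §3: "`G_{(F_∞)_η}/I_η` has profinite order prime to `p`").
* **`natCard_subgroupH1_localSubgroup_eq_natCard_invariants`** — **`#H¹(Hi, B) = #H¹(I, B)^{Hi}`**: the
  five-term sequence `0 → H¹(Hi/I, B^I) → H¹(Hi, B) → H¹(I, B)^{Hi/I} → H²(Hi/I, B^I)` (the tree's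
  numerical Hochschild–Serre `natCard_one_eq_mul`) with BOTH outer terms zero
  (`UniversalToricDescentProPrimeToPVanishing`, arbitrary action). Here `H¹(I, B)^{Hi}` is the set of
  classes of `H¹(I ∩ Hi, B)` fixed by the conjugation action `conjMap` of every `h ∈ Hi`.

This is the reduction of Greenberg–Vatsal's local factor `𝓗_v(K_∞)[p] = H¹(K_{∞,w}, E[p])` (for
unramified `E[p]`) to an INERTIA computation; the evaluation `H¹(I_v, B) ≅ B(−1)`
(`TameInertiaGeneratorEvaluationProofs`) and the Frobenius reduction are the sequel files.
THEOREMS ONLY; no definition, no named fact, no `sorry`. BSD is not advanced by this file.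
References: [GreenbergVatsal2000] §2 Prop. (2.4) and proof (p. 22); [GreenbergLNM1716] §3 Lemma 3.3
(proof, p. 87); [SerreGaloisCohomology1997] I §2.6 (b), I §3.3; [NeukirchSchmidtWingberg2008] (1.6.7).
-/

set_option autoImplicit false
-- `…BirchSwinnertonDyer.BirchSwinnertonDyer.Theorems…` is the problem's mandated namespace (D-0017).
set_option linter.dupNamespace false

noncomputable section

open scoped Classical

namespace Summit.BirchSwinnertonDyer.BirchSwinnertonDyer.Theorems.UniversalToricDescentLocalH1Count

open NumberField IsDedekindDomain Field ValuativeRel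
open Literature.NumberTheory.EllipticCurves Literature.NumberTheory.GaloisRepresentations
  IsDedekindDomain.HeightOneSpectrum ContinuousCohomology
  Summit.BirchSwinnertonDyer.Rank1Residual.Iwasawa.NonsingularTower
  Summit.BirchSwinnertonDyer.Rank1Residual.Iwasawa.NonsplitTower
  Summit.BirchSwinnertonDyer.BirchSwinnertonDyer.Theorems.UniversalToricDescentProPrimeToP

variable {K : Type} [Field K] [NumberField K] {v : HeightOneSpectrum (𝓞 K)} {p : ℕ} [Fact p.Prime]
  (κ : ZpExtension K p)

/-! ### §1 `I_{K_v} ≤ Gal(K̄_v/K_{∞,w})` and the pro-prime-to-`p` quotient -/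

/-- **`I_{K_v} ≤ Gal(K̄_v/K_{∞,w})`** for every `ℤ_p`-extension and `v ∤ p` (`ℤ_p`-extensions are
unramified outside `p`, Washington Prop. 13.2 = tree `ZpExtension.inertia_le_kerSubgroup_holds`), in the
`absInertia` currency (`inertia_eq_absInertia`). [cite: Washington1997, Prop. 13.2] -/
theorem absInertia_le_localSubgroup (hpv : (p : 𝓞 K) ∉ v.asIdeal) :
    absInertia (v.adicCompletion K) ≤ localSubgroup κ.kerSubgroup (v.adicCompletion K) := by
  haveI : CharZero (v.adicCompletion K) :=
    charZero_of_injective_algebraMap (algebraMap K (v.adicCompletion K)).injective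
  obtain ⟨w, hw⟩ := v.exists_spectralValuation
  obtain ⟨𝔐, h𝔐⟩ := v.localPrimesAbove_nonempty
  rw [← v.inertia_eq_absInertia hw h𝔐]
  exact fun σ hσ ↦ (mem_localSubgroup_iff _ _ σ).mpr
    (ZpExtension.inertia_le_kerSubgroup_holds K p κ hpv (primeBelow_mem_primesAbove h𝔐)
      (v.resGalOfEmb_mem_inertia_primeBelow (closureEmb (K := K) (v.adicCompletion K)) 𝔐 hσ))

/-- **`Gal(K̄_v/K_{∞,w}) / I_{K_v}` is pro-prime-to-`p`** at a place `v ∤ p` not split completely in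
the `ℤ_p`-extension: every open normal subgroup of the quotient has index prime to `p`. An open
subgroup `V ⊇ I` of `Hi` contains `Hi ∩ N·I` for an open normal `N ≤ Γ_{K_v}`, whose index in `Hi` is
prime to `p` (`relIndex_sup_inertia_coprime`). [cite: GreenbergLNM1716, §3 Lemma 3.3 (proof, p. 87)]
[cite: GreenbergVatsal2000, §2 Prop. (2.4) (proof)] -/
theorem coprime_index_of_quotient_localSubgroup_absInertia (hpv : (p : 𝓞 K) ∉ v.asIdeal)
    (hns : ∃ σ : absoluteGaloisGroup (v.adicCompletion K),
      σ ∉ localSubgroup κ.kerSubgroup (v.adicCompletion K))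
    (U : Subgroup (localSubgroup κ.kerSubgroup (v.adicCompletion K) ⧸
      (absInertia (v.adicCompletion K)).subgroupOf (localSubgroup κ.kerSubgroup (v.adicCompletion K))))
    (hU : IsOpen (U : Set (localSubgroup κ.kerSubgroup (v.adicCompletion K) ⧸
      (absInertia (v.adicCompletion K)).subgroupOf
        (localSubgroup κ.kerSubgroup (v.adicCompletion K))))) :
    U.index.Coprime p := by
  -- notation
  let G : Type := absoluteGaloisGroup (v.adicCompletion K)
  let Hi : Subgroup G := localSubgroup κ.kerSubgroup (v.adicCompletion K)
  let I : Subgroup G := absInertia (v.adicCompletion K)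
  let N : Subgroup Hi := I.subgroupOf Hi
  haveI : CharZero (v.adicCompletion K) :=
    charZero_of_injective_algebraMap (algebraMap K (v.adicCompletion K)).injective
  haveI := absoluteGaloisGroup_compactSpace (v.adicCompletion K)
  obtain ⟨w, hw⟩ := v.exists_spectralValuation
  obtain ⟨𝔐, h𝔐⟩ := v.localPrimesAbove_nonempty
  have hIeq : 𝔐.inertia G = I := v.inertia_eq_absInertia hw h𝔐
  have hle : I ≤ Hi := absInertia_le_localSubgroup κ hpv
  -- pull `U` back to an open subgroup `V` of `Hi` containing `N`
  let V : Subgroup Hi := U.comap (QuotientGroup.mk' N)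
  have hVidx : V.index = U.index :=
    Subgroup.index_comap_of_surjective U (QuotientGroup.mk'_surjective N)
  have hVopen : IsOpen (V : Set Hi) := hU.preimage QuotientGroup.continuous_mk
  have hNV : N ≤ V := fun x hx ↦ by
    show QuotientGroup.mk' N x ∈ U
    rw [show QuotientGroup.mk' N x = 1 from (QuotientGroup.eq_one_iff x).mpr hx]
    exact U.one_mem
  -- an open normal `N₀ ≤ Γ_{K_v}` with `Hi ∩ N₀ ⊆ V`
  obtain ⟨O, hO, hOV⟩ := isOpen_induced_iff.mp hVopen
  have h1O : (1 : G) ∈ O := by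
    have h : (1 : Hi) ∈ (Subtype.val ⁻¹' O : Set Hi) := by rw [hOV]; exact V.one_mem
    exact h
  obtain ⟨N₀, hN₀⟩ := ProfiniteGrp.exist_openNormalSubgroup_sub_open_nhds_of_one hO h1O
  -- `Hi ∩ N₀·I ≤ V`
  haveI : (𝔐.inertia G).Normal := v.inertia_normal_of_mem_localPrimesAbove h𝔐
  have hsub : (N₀.toSubgroup ⊔ 𝔐.inertia G).subgroupOf Hi ≤ V := by
    intro x hx
    rw [Subgroup.mem_subgroupOf] at hx
    have hx' : (x : G) ∈ ((N₀.toSubgroup ⊔ 𝔐.inertia G : Subgroup G) : Set G) := hx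
    rw [Subgroup.normal_mul] at hx'
    obtain ⟨n, hn, i, hi, hni⟩ := Set.mem_mul.mp hx'
    rw [hIeq] at hi
    have hiH : i ∈ Hi := hle hi
    have hnH : n ∈ Hi := by
      have : n = (x : G) * i⁻¹ := by rw [← hni, mul_inv_cancel_right]
      rw [this]
      exact Hi.mul_mem x.2 (Hi.inv_mem hiH)
    have hnV : (⟨n, hnH⟩ : Hi) ∈ V := by
      have : (⟨n, hnH⟩ : Hi) ∈ (Subtype.val ⁻¹' O : Set Hi) := hN₀ hn
      rw [hOV] at this
      exact this
    have hiV : (⟨i, hiH⟩ : Hi) ∈ V := hNV (Subgroup.mem_subgroupOf.mpr hi)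
    have hx'' : x = ⟨n, hnH⟩ * ⟨i, hiH⟩ := Subtype.ext hni.symm
    rw [hx'']
    exact V.mul_mem hnV hiV
  -- indices
  have hcop := relIndex_sup_inertia_coprime κ hpv hns h𝔐 N₀.toSubgroup N₀.isOpen'
  rw [Subgroup.relIndex] at hcop
  rw [← hVidx]
  exact Nat.Coprime.coprime_dvd_left (Subgroup.index_dvd_of_le hsub) hcop

/-! ### §2 `#H¹(K_{∞,w}, B) = #H¹(I_v, B)^{Gal(K̄_v/K_{∞,w})}` -/

/-- **Greenberg–Vatsal Prop. (2.4), structural half: `#H¹(Gal(K̄_v/K_{∞,w}), B) = #H¹(I_{K_v}, B)^{Hi}`**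
for a finite discrete `p`-primary `Γ_{K_v}`-module `B` (continuous action) at a place `v ∤ p` not split
completely in the `ℤ_p`-extension. The right-hand side counts the classes of `H¹(I ∩ Hi, B)`
(`I ∩ Hi = I` as `I ≤ Hi`) fixed by the conjugation action `conjMap` of every `h ∈ Hi`
(`(h·φ)(x) = h • φ(h⁻¹ x h)` on cocycles). Proof: the numerical five-term sequence
(`natCard_one_eq_mul`) for the closed normal subgroup `I ∩ Hi` of the profinite group `Hi`, whose
quotient is pro-prime-to-`p` (§1), so that `H¹(Hi/I, B^I) = H²(Hi/I, B^I) = 0`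
(`UniversalToricDescentProPrimeToPVanishing`); `H¹(Hi, B)` is finite by the tree's
`finite_subgroupH1_and_natCard_le`. The normality of `absInertia` is taken as an instance argument
(supply `absInertia_normal_holds`). [cite: GreenbergVatsal2000, §2 Prop. (2.4) and proof (p. 22)]
[cite: GreenbergLNM1716, §3 Lemma 3.3] [cite: SerreGaloisCohomology1997, I §2.6 (b)] -/
theorem natCard_subgroupH1_localSubgroup_eq_natCard_invariants (hpv : (p : 𝓞 K) ∉ v.asIdeal)
    (hns : ∃ σ : absoluteGaloisGroup (v.adicCompletion K),
      σ ∉ localSubgroup κ.kerSubgroup (v.adicCompletion K))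
    {B : Type} [AddCommGroup B] [DistribMulAction (absoluteGaloisGroup (v.adicCompletion K)) B]
    [TopologicalSpace B] [DiscreteTopology B] [Finite B] (hB : ∃ k : ℕ, ∀ b : B, p ^ k • b = 0)
    (hBcard : (Nat.card B).Coprime (ringChar 𝓀[v.adicCompletion K]))
    (hcont : ∀ b : B, Continuous fun g : absoluteGaloisGroup (v.adicCompletion K) ↦ g • b)
    [hIn : (absInertia (v.adicCompletion K)).Normal] :
    Nat.card (Literature.NumberTheory.EllipticCurves.subgroupH1
        (localSubgroup κ.kerSubgroup (v.adicCompletion K)) B) =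
      Nat.card {y : continuousCohomology 1 (subgroupRep
          (discreteTopRep (localSubgroup κ.kerSubgroup (v.adicCompletion K)) B)
          ((absInertia (v.adicCompletion K)).subgroupOf
            (localSubgroup κ.kerSubgroup (v.adicCompletion K)))) //
        ∀ h : localSubgroup κ.kerSubgroup (v.adicCompletion K),
          conjMap (discreteTopRep (localSubgroup κ.kerSubgroup (v.adicCompletion K)) B)
            ((absInertia (v.adicCompletion K)).subgroupOf
              (localSubgroup κ.kerSubgroup (v.adicCompletion K))) h 1 y = y} := by
  -- notation
  let G : Type := absoluteGaloisGroup (v.adicCompletion K)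
  let Hi : Subgroup G := localSubgroup κ.kerSubgroup (v.adicCompletion K)
  let I : Subgroup G := absInertia (v.adicCompletion K)
  let N : Subgroup Hi := I.subgroupOf Hi
  haveI : CharZero (v.adicCompletion K) :=
    charZero_of_injective_algebraMap (algebraMap K (v.adicCompletion K)).injective
  haveI := absoluteGaloisGroup_compactSpace (v.adicCompletion K)
  -- topology of `Hi` and `N`
  have hHic : IsClosed (Hi : Set G) :=
    κ.isClosed_kerSubgroup.preimage (map_continuous (resGal (K := K) (v.adicCompletion K)))
  haveI : CompactSpace Hi := isCompact_iff_compactSpace.mp hHic.isCompact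
  have hNc : IsClosed (N : Set Hi) :=
    (isClosed_absInertia_holds (v.adicCompletion K)).preimage continuous_subtype_val
  haveI : IsClosed (N : Set Hi) := hNc
  haveI : TotallyDisconnectedSpace (Hi ⧸ N) :=
    Literature.GroupTheory.ProfiniteSubquotients.totallyDisconnectedSpace_quotient N hNc
  -- `B` as a `ContinuousRep`; the definitional bridge to `discreteTopRep`
  let ρ : ContinuousRep G ℤ B :=
    { toRepresentation := (discreteContRep G B).toRepresentation
      continuous_smul := continuous_prod_of_discrete_right.mpr fun b ↦ hcont b }
  let ρH : ContinuousRep Hi ℤ B :=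
    ρ.restrict (Literature.NumberTheory.GaloisRepresentations.subgroupIncl Hi)
  have hbridge : ρH.toTopRep = discreteTopRep Hi B := rfl
  -- `H¹(Hi, B)` is finite
  haveI : Finite (continuousCohomology 1 ρH.toTopRep) :=
    (finite_subgroupH1_and_natCard_le κ hpv hns hB hBcard hcont).1
  -- the quotient is pro-prime-to-`p`, so `H¹ = H² = 0` for its `p`-primary module `B^N`
  have hcop : ∀ U : Subgroup (Hi ⧸ N), U.Normal → IsOpen (U : Set (Hi ⧸ N)) → U.index.Coprime p :=
    fun U _ hU ↦ coprime_index_of_quotient_localSubgroup_absInertia κ hpv hns U hU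
  have hMN : ∀ m : ρH.invariantsOf N, ∃ k : ℕ, p ^ k • m = 0 := fun m ↦ by
    obtain ⟨k, hk⟩ := hB
    exact ⟨k, Subtype.ext (by
      rw [← Nat.cast_smul_eq_nsmul ℤ, Submodule.coe_smul, Nat.cast_smul_eq_nsmul, hk,
        Submodule.coe_zero])⟩
  haveI : Subsingleton (continuousCohomology 2 (ρH.quotientInvariants N).toTopRep) :=
    subsingleton_continuousCohomology_two_of_coprime_index (ρH.quotientInvariants N) hcop hMN
  haveI : Subsingleton (continuousCohomology 1 (ρH.quotientInvariants N).toTopRep) :=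
    subsingleton_continuousCohomology_one_of_coprime_index (ρH.quotientInvariants N) hcop hMN
  -- Hochschild–Serre
  have hHS := natCard_one_eq_mul N ρH
  rw [Nat.card_of_subsingleton (0 : continuousCohomology 1 (ρH.quotientInvariants N).toTopRep),
    one_mul] at hHS
  refine hHS.trans (Nat.card_congr ?_)
  exact
    { toFun := fun y ↦ ⟨(HOne.of N ρH).symm y.1, (mem_invariants_hOneRep_iff N ρH y.1).mp y.2⟩
      invFun := fun y ↦ ⟨HOne.of N ρH y.1, (mem_invariants_hOneRep_iff N ρH _).mpr y.2⟩
      left_inv := fun _ ↦ rfl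
      right_inv := fun _ ↦ rfl }

end Summit.BirchSwinnertonDyer.BirchSwinnertonDyer.Theorems.UniversalToricDescentLocalH1Count

end
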